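import Mathlib
import HarnessLib
import Summits.HubbardSuperconductivity.HubbardSuperconductivity.Theorems.KLProgrammeKLRegimeEnginePairTransferMemberPHRowForm
import Summits.HubbardSuperconductivity.HubbardSuperconductivity.Theorems.KLProgrammeKLRegimeEnginePairTransferMassesFlat

/-!
# Route `KLProgramme` — ENGINE item stmt-HubbardSuperconductivity-20437 `KLRegimeEngineV17F2`, class-#5 STEP (X).3 rows form (row `hP` of
# `klmd_defect_le_rows_family`): THE MEMBER PH ROW WITH THE KERNEL PRODUCT SPLIT INTO ITS FREQUENCY-PINNED PART AND A FLAT REMAINDER —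
# `‖S_P‖ ≤ |βL²|²·(‖T⁺‖ + ‖T⁻‖) + ε·(512/3)(βL²)²/Λ(t)²·Σ_p |Φ_j(t)(p)|‖ĝ_K(p)‖`, `T^±` the two SIGNED forward bubbles with the momentum-only weights
# `Y^±(k̃) = Σ_σ (V·V)` read at the pinned loop frequency `ω₀` (cell gate-hubbard-kl, seat hubbard-kl-k3c2-p2 g17)

WHY.  Located reading «(X).3-MASSES-SIGNBLIND» (HOME/STATUS 08-28 09:46Z): the member PH rows of the class-#5 STEP have no sign-blind gain at small
transfer; the ROOM's `(4ⁿ⁺¹)⁻¹ov` / `3·thermalBar` / `|q|/Λ` slots are the SIGNED radial cancellation of the forward bubble, which needs the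
frequency–momentum sum INSIDE the norm and a kernel product that does not depend on the loop frequency.  This file performs exactly that reduction on
the LITERAL `hP` sum, for ANY kernel `V` and ANY `ε`:

* `klms_lines_eq_zero_of_freq` — a loop frequency above `4Λₙ₊₁` kills both line products (slice support, `…EngineFlowSliceWeights`);
* **`klms_memberPH_direct_norm_le`** — with `X(p,σ,p′) = V(p σ 1, p′ σ 0, y, x)·V(p σ 0, p′ σ 1, Q_m−y, Q_m−x)`, its FREQUENCY-PINNED copy
  `X₀(p,σ,p′) = X((ω₀,k̃),σ,(ω₀,k̃′))` and the flatness datum `‖X − X₀‖ ≤ ε` on the slice's frequency window `ω² ≤ (4Λₙ₊₁)²`: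
  `‖S_P‖ ≤ |βL²|²·(‖Σ_p Y⁺(k̃)·Φ_Ẇ(ω_p, e_K k̃)·Φ_{Φ_j}(ω_p, e_K(k̃ + q̃))‖ + ‖Σ_p Y⁻(k̃)·Φ_Ẇ(ω_p, e_K k̃)·Φ_{Φ_j}(ω_p, e_K(k̃ − q̃))‖) + ε·(512/3)(βL²)²/Λ(t)²·Σ_p|Φ_j(t)(p)|‖ĝ_K p‖`
  (`q̃ = x − y`; `Y⁺(k̃) = Σ_σ X₀` at `(k̃, k̃+q̃)`, `Y⁻(k̃) = Σ_σ X₀` at `(k̃−q̃, k̃)`).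
The two remaining sums are literally the left sides of `klfl_lattice_soft_bubble_norm_le_model` (…LatticeSoftBubbleModel, index `n+1`, weights
`klWdC Λ(t)` / `klPhiC Λ_j Λ(t)` with `klfw_*_hypotheses`, planar weight `klpeExt Y^±` of …LatticePeriodicExtension, `q₀ = 0`), up to the normalisation
`klrf_sum_freqMomentum_eq_smul`; the last term is the flat member mass (`softSum_eq_klSoftMass`, `direct_row_flat_le`).  The currency of `ε` (the loop-frequency
flatness of the class-#1 kernels on the slice window) is the consumer's — (E4) first moments, or a dressing-moments row — see SIGNED-ROWS-DESIGN.md §4–§5.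

Pure algebra/analysis over landed rows; nothing about the model's effective action is asserted; nothing asserts (X).3, (c), K3 or superconductivity.
-/

noncomputable section

namespace Summit.HubbardSuperconductivity.HubbardSuperconductivity.Theorems.KLRegimeSplit

set_option linter.dupNamespace false -- summit = problem name (single-conjunct summit), D-0017

open Real Set Finset Complex Literature.MathematicalPhysics.QuantumLattice Literature.Probability.LatticeModels
open Summit.HubbardSuperconductivity.HubbardSuperconductivity.Theorems.KLProgrammeLegKernels
open Summit.HubbardSuperconductivity.HubbardSuperconductivity.Theorems.KLRegimeWick
open Summit.HubbardSuperconductivity.HubbardSuperconductivity.Theorems.TwoPointAssembly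
open Summit.HubbardSuperconductivity.HubbardSuperconductivity.Theorems.DispersionFlow

variable {L M : ℕ} [NeZero L] [NeZero M] (β μ : ℝ) (K : TrigPolyC4v)

/-! ## §1 A loop frequency above `4Λₙ₊₁` kills the slice line -/

omit [NeZero L] [NeZero M] in
/-- For `Λ ∈ [Λₙ₊₁, Λₙ]` and `ω_p² > (4Λₙ₊₁)²` the slice weight vanishes at `p`: `Ẇ_Λ(p) = 0`. -/
theorem klms_Wd_eq_zero_of_freq (n : ℕ) {Λ : ℝ} (hlo : klScale klE0 (n + 1) ≤ Λ) (hhi : Λ ≤ klScale klE0 n) (p : FreqMomentum L M)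
    (hω : (4 * klScale klE0 (n + 1)) ^ 2 < matsubaraFreq β M p.1 ^ 2) :
    deriv (fun Λ' : ℝ => hubbardCutoffWeightCT L M β μ K Λ' p) Λ = 0 := by
  have hΛ1 := klth_klScale_pos (n + 1)
  have hΛ : 0 < Λ := hΛ1.trans_le hlo
  rw [klfw_Wd_eq_klWd β μ K hΛ.ne' p]
  refine klWd_eq_zero_of_ge hΛ ?_
  have h4 : klScale klE0 n = 4 * klScale klE0 (n + 1) := by rw [klth_klScale_succ]; ring
  have hΛsq : Λ ^ 2 ≤ (4 * klScale klE0 (n + 1)) ^ 2 := by rw [← h4]; exact pow_le_pow_left₀ hΛ.le hhi 2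
  nlinarith [sq_nonneg (nambuXiCT L μ K p.2)]

/-! ## §2 The member PH row: pinned part + flat remainder -/

/-- **THE MEMBER PH ROW `hP`, KERNEL PRODUCT SPLIT** (see the module docstring).  Hypotheses: `0 < β`, `t ∈ [0,1]`, the STEP's weight pins `hΦ hWd`,
`0 ≤ ε`, and the flatness of the kernel product in the loop frequency on the window `ω² ≤ (4Λₙ₊₁)²`. -/
theorem klms_memberPH_direct_norm_le (hβ : 0 < β) (n : ℕ) {t : ℝ} (ht : t ∈ Icc (0 : ℝ) 1)
    (Φ : ℕ → ℝ → FreqMomentum L M → ℝ) (hΦ : Φ = fun j t k => (softSymbolCompl L M β μ K (n + 1) j) k + (hubbardCutoffWeightCT L M β μ K (klScale klE0 (n + 1)) k -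
            hubbardCutoffWeightCT L M β μ K (klScale klE0 n + t * (klScale klE0 (n + 1) - klScale klE0 n)) k))
    (Wd : ℝ → FreqMomentum L M → ℝ) (hWd : Wd = fun t k => deriv (fun Λ' : ℝ => hubbardCutoffWeightCT L M β μ K Λ' k) (klScale klE0 n + t * (klScale klE0 (n + 1) - klScale klE0 n)))
    (V : ℕ → ℝ → (Fin 4 → HubbardFieldIdx L M) → ℂ) (j : ℕ) (Qm x y : TorusSite 2 L) {ε : ℝ} (hε : 0 ≤ ε)
    (hflat : ∀ (i : MatsubaraIdx M) (σ : Fin 2) (k k' : TorusSite 2 L), matsubaraFreq β M i ^ 2 ≤ (4 * klScale klE0 (n + 1)) ^ 2 →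
      ‖V j t ![(((i, k), σ), 1), (((i, k'), σ), 0), (((omega0 M, y), 0), 0), (((omega0 M, x), 0), 1)] *
            V j t ![(((i, k), σ), 0), (((i, k'), σ), 1), ((((omega0 M).rev, Qm - y), 1), 0), ((((omega0 M).rev, Qm - x), 1), 1)] -
          V j t ![(((omega0 M, k), σ), 1), (((omega0 M, k'), σ), 0), (((omega0 M, y), 0), 0), (((omega0 M, x), 0), 1)] *
            V j t ![(((omega0 M, k), σ), 0), (((omega0 M, k'), σ), 1), ((((omega0 M).rev, Qm - y), 1), 0), ((((omega0 M).rev, Qm - x), 1), 1)]‖ ≤ ε) :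
    ‖∑ p : FreqMomentum L M, ∑ σ : Fin 2, ∑ p' : FreqMomentum L M,
        if matsubaraInt M p'.1 + matsubaraInt M (omega0 M) = matsubaraInt M p.1 + matsubaraInt M (omega0 M) ∧ p'.2 = p.2 + x - y then
          ((((((Φ j t p) : ℝ) : ℂ) * (((β * (L : ℝ) ^ 2 : ℝ) : ℂ) * propCT L M β μ K p)) * ((((Wd t p') : ℝ) : ℂ) * (((β * (L : ℝ) ^ 2 : ℝ) : ℂ) * propCT L M β μ K p'))) +
              (((((Wd t p) : ℝ) : ℂ) * (((β * (L : ℝ) ^ 2 : ℝ) : ℂ) * propCT L M β μ K p)) * ((((Φ j t p') : ℝ) : ℂ) * (((β * (L : ℝ) ^ 2 : ℝ) : ℂ) * propCT L M β μ K p')))) *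
            (V j t ![((p, σ), 1), ((p', σ), 0), (((omega0 M, y), 0), 0), (((omega0 M, x), 0), 1)] *
              V j t ![((p, σ), 0), ((p', σ), 1), ((((omega0 M).rev, Qm - y), 1), 0), ((((omega0 M).rev, Qm - x), 1), 1)])
        else 0‖ ≤
      (β * (L : ℝ) ^ 2) ^ 2 *
          (‖∑ p : FreqMomentum L M,
              (∑ σ : Fin 2, V j t ![(((omega0 M, p.2), σ), 1), (((omega0 M, p.2 + (x - y)), σ), 0), (((omega0 M, y), 0), 0), (((omega0 M, x), 0), 1)] *
                  V j t ![(((omega0 M, p.2), σ), 0), (((omega0 M, p.2 + (x - y)), σ), 1), ((((omega0 M).rev, Qm - y), 1), 0), ((((omega0 M).rev, Qm - x), 1), 1)]) *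
                (klfb_prop (klWdC (klScale klE0 n + t * (klScale klE0 (n + 1) - klScale klE0 n))) (matsubaraFreq β M p.1) (nambuXiCT L μ K p.2) *
                  klfb_prop (klPhiC (klScale klE0 j) (klScale klE0 n + t * (klScale klE0 (n + 1) - klScale klE0 n))) (matsubaraFreq β M p.1)
                    (nambuXiCT L μ K (p.2 + (x - y))))‖ +
            ‖∑ p : FreqMomentum L M,
              (∑ σ : Fin 2, V j t ![(((omega0 M, p.2 + -(x - y)), σ), 1), (((omega0 M, p.2), σ), 0), (((omega0 M, y), 0), 0), (((omega0 M, x), 0), 1)] *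
                  V j t ![(((omega0 M, p.2 + -(x - y)), σ), 0), (((omega0 M, p.2), σ), 1), ((((omega0 M).rev, Qm - y), 1), 0), ((((omega0 M).rev, Qm - x), 1), 1)]) *
                (klfb_prop (klWdC (klScale klE0 n + t * (klScale klE0 (n + 1) - klScale klE0 n))) (matsubaraFreq β M p.1) (nambuXiCT L μ K p.2) *
                  klfb_prop (klPhiC (klScale klE0 j) (klScale klE0 n + t * (klScale klE0 (n + 1) - klScale klE0 n))) (matsubaraFreq β M p.1)
                    (nambuXiCT L μ K (p.2 + -(x - y))))‖) +
        ε * (512 / 3 * (β * (L : ℝ) ^ 2) ^ 2 / (klScale klE0 n + t * (klScale klE0 (n + 1) - klScale klE0 n)) ^ 2 *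
          ∑ p : FreqMomentum L M, |Φ j t p| * ‖propCT L M β μ K p‖) := by
  set Λt : ℝ := klScale klE0 n + t * (klScale klE0 (n + 1) - klScale klE0 n) with hΛt
  obtain ⟨hlo, hhi⟩ := scaleAt_mem n ht
  have hΛpos : 0 < Λt := (klth_klScale_pos (n + 1)).trans_le hlo
  -- the resolved kernel product and its frequency-pinned copy
  set X : FreqMomentum L M → Fin 2 → FreqMomentum L M → ℂ := fun p σ p' =>
    V j t ![((p, σ), 1), ((p', σ), 0), (((omega0 M, y), 0), 0), (((omega0 M, x), 0), 1)] *
      V j t ![((p, σ), 0), ((p', σ), 1), ((((omega0 M).rev, Qm - y), 1), 0), ((((omega0 M).rev, Qm - x), 1), 1)] with hX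
  set X₀ : FreqMomentum L M → Fin 2 → FreqMomentum L M → ℂ := fun p σ p' =>
    V j t ![(((omega0 M, p.2), σ), 1), (((omega0 M, p'.2), σ), 0), (((omega0 M, y), 0), 0), (((omega0 M, x), 0), 1)] *
      V j t ![(((omega0 M, p.2), σ), 0), (((omega0 M, p'.2), σ), 1), ((((omega0 M).rev, Qm - y), 1), 0), ((((omega0 M).rev, Qm - x), 1), 1)] with hX₀
  -- abbreviations for the lines
  set G : FreqMomentum L M → ℂ := fun p => (((β * (L : ℝ) ^ 2 : ℝ)) : ℂ) * propCT L M β μ K p with hG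
  set ln : FreqMomentum L M → FreqMomentum L M → ℂ := fun p p' =>
    (((Φ j t p : ℝ)) : ℂ) * G p * ((((Wd t p' : ℝ)) : ℂ) * G p') + (((Wd t p : ℝ)) : ℂ) * G p * ((((Φ j t p' : ℝ)) : ℂ) * G p') with hln
  -- rewrite the goal's summand as `ite c (ln·X)`
  have hgoal : (fun p : FreqMomentum L M => ∑ σ : Fin 2, ∑ p' : FreqMomentum L M,
        if matsubaraInt M p'.1 + matsubaraInt M (omega0 M) = matsubaraInt M p.1 + matsubaraInt M (omega0 M) ∧ p'.2 = p.2 + x - y then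
          ((((((Φ j t p) : ℝ) : ℂ) * (((β * (L : ℝ) ^ 2 : ℝ) : ℂ) * propCT L M β μ K p)) * ((((Wd t p') : ℝ) : ℂ) * (((β * (L : ℝ) ^ 2 : ℝ) : ℂ) * propCT L M β μ K p'))) +
              (((((Wd t p) : ℝ) : ℂ) * (((β * (L : ℝ) ^ 2 : ℝ) : ℂ) * propCT L M β μ K p)) * ((((Φ j t p') : ℝ) : ℂ) * (((β * (L : ℝ) ^ 2 : ℝ) : ℂ) * propCT L M β μ K p')))) *
            (V j t ![((p, σ), 1), ((p', σ), 0), (((omega0 M, y), 0), 0), (((omega0 M, x), 0), 1)] *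
              V j t ![((p, σ), 0), ((p', σ), 1), ((((omega0 M).rev, Qm - y), 1), 0), ((((omega0 M).rev, Qm - x), 1), 1)])
        else 0) =
      fun p => ∑ σ : Fin 2, ∑ p' : FreqMomentum L M,
        ((if matsubaraInt M p'.1 + matsubaraInt M (omega0 M) = matsubaraInt M p.1 + matsubaraInt M (omega0 M) ∧ p'.2 = p.2 + x - y then ln p p' * X₀ p σ p' else 0) +
          (if matsubaraInt M p'.1 + matsubaraInt M (omega0 M) = matsubaraInt M p.1 + matsubaraInt M (omega0 M) ∧ p'.2 = p.2 + x - y then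
            ln p p' * (X p σ p' - X₀ p σ p') else 0)) := by
    funext p
    refine Finset.sum_congr rfl fun σ _ => Finset.sum_congr rfl fun p' _ => ?_
    split_ifs
    · simp only [hln, hX, hX₀, hG]; ring
    · simp
  rw [show (∑ p : FreqMomentum L M, ∑ σ : Fin 2, ∑ p' : FreqMomentum L M,
        if matsubaraInt M p'.1 + matsubaraInt M (omega0 M) = matsubaraInt M p.1 + matsubaraInt M (omega0 M) ∧ p'.2 = p.2 + x - y then
          ((((((Φ j t p) : ℝ) : ℂ) * (((β * (L : ℝ) ^ 2 : ℝ) : ℂ) * propCT L M β μ K p)) * ((((Wd t p') : ℝ) : ℂ) * (((β * (L : ℝ) ^ 2 : ℝ) : ℂ) * propCT L M β μ K p'))) +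
              (((((Wd t p) : ℝ) : ℂ) * (((β * (L : ℝ) ^ 2 : ℝ) : ℂ) * propCT L M β μ K p)) * ((((Φ j t p') : ℝ) : ℂ) * (((β * (L : ℝ) ^ 2 : ℝ) : ℂ) * propCT L M β μ K p')))) *
            (V j t ![((p, σ), 1), ((p', σ), 0), (((omega0 M, y), 0), 0), (((omega0 M, x), 0), 1)] *
              V j t ![((p, σ), 0), ((p', σ), 1), ((((omega0 M).rev, Qm - y), 1), 0), ((((omega0 M).rev, Qm - x), 1), 1)])
        else 0) = ∑ p : FreqMomentum L M, (fun p : FreqMomentum L M => ∑ σ : Fin 2, ∑ p' : FreqMomentum L M,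
        if matsubaraInt M p'.1 + matsubaraInt M (omega0 M) = matsubaraInt M p.1 + matsubaraInt M (omega0 M) ∧ p'.2 = p.2 + x - y then
          ((((((Φ j t p) : ℝ) : ℂ) * (((β * (L : ℝ) ^ 2 : ℝ) : ℂ) * propCT L M β μ K p)) * ((((Wd t p') : ℝ) : ℂ) * (((β * (L : ℝ) ^ 2 : ℝ) : ℂ) * propCT L M β μ K p'))) +
              (((((Wd t p) : ℝ) : ℂ) * (((β * (L : ℝ) ^ 2 : ℝ) : ℂ) * propCT L M β μ K p)) * ((((Φ j t p') : ℝ) : ℂ) * (((β * (L : ℝ) ^ 2 : ℝ) : ℂ) * propCT L M β μ K p')))) *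
            (V j t ![((p, σ), 1), ((p', σ), 0), (((omega0 M, y), 0), 0), (((omega0 M, x), 0), 1)] *
              V j t ![((p, σ), 0), ((p', σ), 1), ((((omega0 M).rev, Qm - y), 1), 0), ((((omega0 M).rev, Qm - x), 1), 1)])
        else 0) p from rfl, hgoal]
  simp only [Finset.sum_add_distrib]
  refine (norm_add_le _ _).trans (add_le_add ?_ ?_)
  · -- the pinned part: collapse, re-index, model lines
    have h := klrf_direct_sum_eq (Φ j t) (Wd t) G X₀ x y
    have hln' : ∀ p p', ln p p' = (((Φ j t p : ℝ)) : ℂ) * G p * ((((Wd t p' : ℝ)) : ℂ) * G p') + (((Wd t p : ℝ)) : ℂ) * G p * ((((Φ j t p' : ℝ)) : ℂ) * G p') :=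
      fun p p' => rfl
    simp_rw [hln'] at *
    rw [h]
    subst hΦ hWd
    have hlines : ∀ (p : FreqMomentum L M) (k' : TorusSite 2 L),
        (((deriv (fun Λ' : ℝ => hubbardCutoffWeightCT L M β μ K Λ' p) Λt : ℝ)) : ℂ) * G p *
            ((((softSymbolCompl L M β μ K (n + 1) j (p.1, k') +
                  (hubbardCutoffWeightCT L M β μ K (klScale klE0 (n + 1)) (p.1, k') - hubbardCutoffWeightCT L M β μ K Λt (p.1, k')) : ℝ)) : ℂ) * G (p.1, k')) =
          (((β * (L : ℝ) ^ 2 : ℝ)) : ℂ) ^ 2 *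
            (klfb_prop (klWdC Λt) (matsubaraFreq β M p.1) (nambuXiCT L μ K p.2) *
              klfb_prop (klPhiC (klScale klE0 j) Λt) (matsubaraFreq β M p.1) (nambuXiCT L μ K k')) :=
      fun p k' => klrf_lines_eq μ K hβ.ne' n j hΛpos.ne' p k'
    have e1 : (∑ p : FreqMomentum L M, (((deriv (fun Λ' : ℝ => hubbardCutoffWeightCT L M β μ K Λ' p) Λt : ℝ)) : ℂ) * G p *
          ((((softSymbolCompl L M β μ K (n + 1) j (p.1, p.2 + (x - y)) +
                (hubbardCutoffWeightCT L M β μ K (klScale klE0 (n + 1)) (p.1, p.2 + (x - y)) - hubbardCutoffWeightCT L M β μ K Λt (p.1, p.2 + (x - y))) : ℝ)) : ℂ) *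
            G (p.1, p.2 + (x - y))) * ∑ σ : Fin 2, X₀ p σ (p.1, p.2 + (x - y))) =
        (((β * (L : ℝ) ^ 2 : ℝ)) : ℂ) ^ 2 * ∑ p : FreqMomentum L M,
          (∑ σ : Fin 2, X₀ p σ (p.1, p.2 + (x - y))) *
            (klfb_prop (klWdC Λt) (matsubaraFreq β M p.1) (nambuXiCT L μ K p.2) *
              klfb_prop (klPhiC (klScale klE0 j) Λt) (matsubaraFreq β M p.1) (nambuXiCT L μ K (p.2 + (x - y)))) := by
      rw [Finset.mul_sum]; exact Finset.sum_congr rfl fun p _ => by rw [hlines]; ring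
    have e2 : (∑ p : FreqMomentum L M, (((deriv (fun Λ' : ℝ => hubbardCutoffWeightCT L M β μ K Λ' p) Λt : ℝ)) : ℂ) * G p *
          ((((softSymbolCompl L M β μ K (n + 1) j (p.1, p.2 + -(x - y)) +
                (hubbardCutoffWeightCT L M β μ K (klScale klE0 (n + 1)) (p.1, p.2 + -(x - y)) - hubbardCutoffWeightCT L M β μ K Λt (p.1, p.2 + -(x - y))) : ℝ)) : ℂ) *
            G (p.1, p.2 + -(x - y))) * ∑ σ : Fin 2, X₀ (p.1, p.2 + -(x - y)) σ p) =
        (((β * (L : ℝ) ^ 2 : ℝ)) : ℂ) ^ 2 * ∑ p : FreqMomentum L M,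
          (∑ σ : Fin 2, X₀ (p.1, p.2 + -(x - y)) σ p) *
            (klfb_prop (klWdC Λt) (matsubaraFreq β M p.1) (nambuXiCT L μ K p.2) *
              klfb_prop (klPhiC (klScale klE0 j) Λt) (matsubaraFreq β M p.1) (nambuXiCT L μ K (p.2 + -(x - y)))) := by
      rw [Finset.mul_sum]; exact Finset.sum_congr rfl fun p _ => by rw [hlines]; ring
    rw [e1, e2]
    have hnorm : ‖(((β * (L : ℝ) ^ 2 : ℝ)) : ℂ) ^ 2‖ = (β * (L : ℝ) ^ 2) ^ 2 := by
      rw [norm_pow, Complex.norm_real, Real.norm_of_nonneg (by positivity)]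
    refine (norm_add_le _ _).trans ?_
    rw [norm_mul, norm_mul, hnorm, ← mul_add]
  · -- the flat remainder
    have hterm : ∀ (p : FreqMomentum L M) (σ : Fin 2) (p' : FreqMomentum L M),
        ‖(if matsubaraInt M p'.1 + matsubaraInt M (omega0 M) = matsubaraInt M p.1 + matsubaraInt M (omega0 M) ∧ p'.2 = p.2 + x - y then
            ln p p' * (X p σ p' - X₀ p σ p') else 0)‖ ≤
          ε * (if matsubaraInt M p'.1 + matsubaraInt M (omega0 M) = matsubaraInt M p.1 + matsubaraInt M (omega0 M) ∧ p'.2 = p.2 + x - y then ‖ln p p'‖ else 0) := by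
      intro p σ p'
      split_ifs with hc
      · obtain ⟨hω, hk⟩ := hc
        have h1' : p'.1 = p.1 := by
          have h3 : matsubaraInt M p'.1 = matsubaraInt M p.1 := by linarith
          simp only [matsubaraInt] at h3
          exact Fin.ext (by omega)
        by_cases hwin : matsubaraFreq β M p.1 ^ 2 ≤ (4 * klScale klE0 (n + 1)) ^ 2
        · rw [norm_mul, mul_comm]
          refine mul_le_mul_of_nonneg_right ?_ (norm_nonneg _)
          have hp' : p' = (p.1, p'.2) := Prod.ext h1' rfl
          have h := hflat p.1 σ p.2 p'.2 hwin
          simp only [hX, hX₀]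
          rw [hp']
          exact h
        · -- outside the window both slice factors vanish, so `ln p p' = 0`
          have hω' : (4 * klScale klE0 (n + 1)) ^ 2 < matsubaraFreq β M p.1 ^ 2 := not_le.mp hwin
          have hz : Wd t p = 0 := by simp only [hWd]; exact klms_Wd_eq_zero_of_freq β μ K n hlo hhi p hω'
          have hz' : Wd t p' = 0 := by
            simp only [hWd]; refine klms_Wd_eq_zero_of_freq β μ K n hlo hhi p' ?_; rw [h1']; exact hω'
          have hln0 : ln p p' = 0 := by simp only [hln, hz, hz']; simp
          rw [hln0]
          simp
      · simp
    calc ‖∑ p : FreqMomentum L M, ∑ σ : Fin 2, ∑ p' : FreqMomentum L M,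
            (if matsubaraInt M p'.1 + matsubaraInt M (omega0 M) = matsubaraInt M p.1 + matsubaraInt M (omega0 M) ∧ p'.2 = p.2 + x - y then
              ln p p' * (X p σ p' - X₀ p σ p') else 0)‖
        ≤ ∑ p : FreqMomentum L M, ∑ σ : Fin 2, ∑ p' : FreqMomentum L M,
            ε * (if matsubaraInt M p'.1 + matsubaraInt M (omega0 M) = matsubaraInt M p.1 + matsubaraInt M (omega0 M) ∧ p'.2 = p.2 + x - y then ‖ln p p'‖ else 0) := by
          refine (norm_sum_le _ _).trans (Finset.sum_le_sum fun p _ => (norm_sum_le _ _).trans (Finset.sum_le_sum fun σ _ =>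
            (norm_sum_le _ _).trans (Finset.sum_le_sum fun p' _ => hterm p σ p')))
      _ = ε * ∑ p : FreqMomentum L M, ∑ _σ : Fin 2, ∑ p' : FreqMomentum L M,
            (if matsubaraInt M p'.1 + matsubaraInt M (omega0 M) = matsubaraInt M p.1 + matsubaraInt M (omega0 M) ∧ p'.2 = p.2 + x - y then ‖ln p p'‖ else 0) := by
          simp only [Finset.mul_sum]
      _ ≤ ε * (512 / 3 * (β * (L : ℝ) ^ 2) ^ 2 / Λt ^ 2 * ∑ p : FreqMomentum L M, |Φ j t p| * ‖propCT L M β μ K p‖) := by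
          refine mul_le_mul_of_nonneg_left ?_ hε
          have h := direct_mass_le_softSum β μ K hβ hΛpos (Φ j t) x y
          subst hWd
          simpa only [hln, hG] using h

end Summit.HubbardSuperconductivity.HubbardSuperconductivity.Theorems.KLRegimeSplit

end
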